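import Summits.QuantumFields.BalabanUV.T4Continuum.Support.VariationalCovariantInterpolant

/-!
# T⁴ programme, spine node NE2 (U1a), lane P2 — SUPPLIER LEAF ONE⁺ OF THE VARIATIONAL ROUTE, PART 2: THE ONE-STEP CONSISTENCY BOUND IN
# LATTICE UNITS (block sums with the main term's constant EXACTLY 1, the lattice END); the physical-units END and the block-spin reading in
# the capstone's letters are part 3, `VariationalCovariantOneStepPhys`

NE2 formalisation swarm `b2b-balaban-t4-ne2-formalise-*`, leaf 01 GEN 2 (`prover-b2b-balaban-t4-ne2-formalise-leaf-01-g2-0`), SUPPLIER SEAT for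
leaf ONE⁺ («s5») of the P2 (variational) skeleton `t4/skeletons/NE2-t4-ne2-p2.md` v0.6 §2.C ∕ §7; journal CLAIM CLAIMS.log l.8374 (+ l.8383).
Parts 0–1: `VariationalCovariantWeights` (weights, counts, cross-term identity), `VariationalCovariantInterpolant` (the competitor
`Λ′ = conj T′ · Φ`, exact constraint `Qc_interp`, exact bond identities, pointwise bound `norm_cD_interp_le`, size `nsq_PhiF_le`).

HONEST FRAMING (T4-DAG p. 1).  Rung (B)+1 only — NOT infinite volume, NOT a mass gap, NOT Clay.  Node NE2 is NOT IN PRINT and NOT proved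
here.  MODEL LEVEL (U(1) charged scalar = King's model with background; [Balaban1985BackgroundPropagators] (3.3)/(3.19)/(3.23) SHAPES only):
unit coarse bond phases `Rc`, fine bond phases `R′`, unit one-step site transports `T′` are DATA; the two ONE-BLOCK TRANSPORT DEFECTS are
DATA: in-block `|R′(x,μ)·conj T′(x+e_μ)·T′(x) − 1| ≤ m` (bonds inside a block; the UB⁺ file's `hw`) and block-crossing
`|R′(x,μ)·conj T′(x+e_μ)·T′(x) − Rc(y,μ)| ≤ m` (bonds leaving block `y` through its far `μ`-face; the nature of FED⁺'s `mis`).  ONE block step —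
no `k`, no tower, no rate; nothing of node NE3; no propagator, no Fourier.  What is proved is OURS; nothing printed is a hypothesis; no
`def`; no `sorry`; axioms standard.  HONEST DEPENDENCY (cell, verbatim): continuum YM on T⁴ ⇐ BetaPertH ∧ nine spine estimates (0/9 proved);
BetaPertH ⇐ (D1) ∧ (D4) ∧ CAP+tail; G-an2-4 gates asym, D1 and NE2/3/4.

THE STATEMENTS.  Lattice units (`X = Σ_μ dirU N Rc λ μ`, `HESS = hess N Rc λ = Σ_{μ,ν,y}|(D⁺_μD⁺_νλ)(y)|²`, `Y = nsq λ`):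

  `Σ_μ dirU (fine L N) R′ Λ′ μ ≤ ( √( L^d/L²·X + (d/4 + 1/2)·L^d/L·HESS ) + √d·m·√(2(1+d²)·L^d·Y) )²`        (`sum_dirU_interp_le`)

— the MAIN TERM `L^d/L²·X` has constant EXACTLY 1 (every one of the `L^d` fine `μ`-bonds of block `y` carries the frame increment
`(1/L)(D⁺_μλ)(y)`; the main × second-order cross term is `+L^{d−2}·(L−1)/(2L)·Σ_y|(D⁺_μD⁺_μλ)(y)|² ≥ 0` by `re_sum_conj_mul_cD` and the
weighted face count — it is NOT estimated by Cauchy–Schwarz, which would cost a first-order `√(X·HESS)`).  Physical units at level `n = L^k`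
in the letters of the capstone `VariationalCovariantScalarPair` (p211992: `Sc`, `Sf`, `qW`, `Q1`) and with `ρ := rho n M Rc` of part 1:

  `Sf n L M R′ Λ′ ≤ ( √( Sc n M Rc λ + (d/4 + 1/2)·(L/n²)·ρ λ ) + √(2d(1+d²))·(n·L·m)·√(qW n M λ) )²`                  (`Sf_interp_le`)
  `blockSpin (Q1 n L M T′) (Sf n L M R′) λ ≤ (the same)`                                                              (`blockSpin_Q1_le`, ONE⁺)

and, for transport-FLAT one-step data (`m = 0`, e.g. `U = 1`), the purely ADDITIVE `blockSpin … λ ≤ Sc λ + (d/4 + 1/2)·(L/n²)·ρ λ`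
(`blockSpin_Q1_le_flat`) = the capstone's binder `hONE` with `ε₁ = (d/4 + 1/2)·L·n⁻²`, `ε₂ = 0`.  SHAPE NOTE (located before proving, journal
l.8374): with `m > 0` the honest bound carries the LINEAR cross term `2√(Sc + ε₁ρ)·δ₁√qW`, `δ₁ = √(2d(1+d²))·nLm ≍ α·L` for the unit-scale-smooth
class (`m ≍ α·n⁻²`·(L-block), `n·L·m ≍ αL·L^{−k}`… first order in the field strength — the owner's numerics N-ne2p2g10-1), which no additive
`Sc + ε₁ρ + ε₂qW` with coefficient 1 on `Sc` absorbs; the consumer's `pair_bracket` handles it at the coarse minimiser by `defect_bound`-type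
bookkeeping (as for FED⁺).  NOT CLAIMED: REG⁺ (the bound of `ρ` at minimisers), UB⁺, the identification of `T′`, `Rc`, `R′` with Bałaban's
`U(Γ)`, `Ū`, `U′` (model level), colour `o > 1` (same computation with `T′ᴴ`), multi-region versions.  NE2 NOT proved; spine 0/9 unchanged.
-/

noncomputable section

namespace Summit.QuantumFields.BalabanUV.T4Continuum.VariationalCovariantOneStep

open Finset
open scoped ComplexConjugate
open Literature.MathematicalPhysics.QuantumFieldTheory.Balaban1983to89
open Literature.MathematicalPhysics.QuantumFieldTheory.Balaban1983to89.B5Prop11Plancherel (Tor fine unitVec)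
open Literature.MathematicalPhysics.QuantumFieldTheory.Balaban1983to89.B5Prop11Lower (nsq nsq_nonneg)
open Literature.MathematicalPhysics.QuantumFieldTheory.Balaban1983to89.B5Block118 (bpt)
open Literature.MathematicalPhysics.QuantumFieldTheory.Balaban1983to89.B5AverageCurlStokes (sum_blocks_real sum_translate)
open Summit.QuantumFields.BalabanUV.T4Continuum.VariationalCovariantFederbush
  (cD dirU Qc dirU_nonneg sq_sum_le_card_mul sum_sq_add_le sum_fin_sq_add_le)
open Summit.QuantumFields.BalabanUV.T4Continuum.VariationalCovariantWeights
  (wt neg_wt_zero_mem sum_ind_last sum_ind_wt_update re_sum_conj_mul_cD)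
open Summit.QuantumFields.BalabanUV.T4Continuum.VariationalCovariantInterpolant
  (Phi PhiF interp hess hess_nonneg PhiF_bpt Qc_interp err2 norm_cD_interp_le norm_err2_le nsq_PhiF_le)

variable {d : ℕ}

/-! ## §1 Block sums of the geometric part: main term EXACTLY `L^d/L²·|D⁺_μλ(y)|²`, cross term ≥ 0 and second order, error second order -/

section Lattice

variable (L : ℕ) [NeZero L] (N : Fin d → ℕ) [∀ μ, NeZero (N μ)] (Rc : Tor N → Fin d → ℂ) (lam : Tor N → ℂ)

omit [∀ μ, NeZero (N μ)] in
/-- the block sum of the second-order parts is a single second difference: `Σ_j err₂(y,j,μ) = L^{d−1}·w_L(0)·(D⁺_μD⁺_μλ)(y)`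
(the mixed directions cancel by the centring of the weights, `sum_ind_wt_update`). [folklore] -/
theorem sum_err2 (y : Tor N) (μ : Fin d) :
    ∑ j : Fin d → Fin L, err2 L N Rc lam y j μ
      = ((((L : ℝ) ^ (d - 1) * wt L 0) : ℝ) : ℂ) * cD N Rc (fun z => cD N Rc lam z μ) y μ := by
  classical
  set DD : Fin d → ℂ := fun ν => cD N Rc (fun z => cD N Rc lam z ν) y μ with hDD
  have h1 : ∀ j : Fin d → Fin L, err2 L N Rc lam y j μ
      = ∑ ν, (((if (j μ : ℕ) + 1 = L then (1 : ℝ) else 0) * wt L (Function.update j μ (0 : Fin L) ν) : ℝ) : ℂ) * DD ν := by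
    intro j
    unfold err2
    split_ifs with h
    · exact Finset.sum_congr rfl fun ν _ => by push_cast; ring
    · symm
      exact Finset.sum_eq_zero fun ν _ => by push_cast; ring
  rw [Finset.sum_congr rfl fun j _ => h1 j, Finset.sum_comm]
  have h2 : ∀ ν : Fin d, ∑ j : Fin d → Fin L,
      (((if (j μ : ℕ) + 1 = L then (1 : ℝ) else 0) * wt L (Function.update j μ (0 : Fin L) ν) : ℝ) : ℂ) * DD ν
      = (((if ν = μ then (L : ℝ) ^ (d - 1) * wt L 0 else 0) : ℝ) : ℂ) * DD ν := by
    intro ν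
    rw [← Finset.sum_mul, ← Complex.ofReal_sum, sum_ind_wt_update L μ ν]
  rw [Finset.sum_congr rfl fun ν _ => h2 ν]
  have h3 : ∀ ν : Fin d, (((if ν = μ then (L : ℝ) ^ (d - 1) * wt L 0 else 0) : ℝ) : ℂ) * DD ν
      = if ν = μ then ((((L : ℝ) ^ (d - 1) * wt L 0) : ℝ) : ℂ) * DD ν else 0 := by
    intro ν; split_ifs <;> simp
  rw [Finset.sum_congr rfl fun ν _ => h3 ν, Finset.sum_ite_eq' Finset.univ μ, if_pos (Finset.mem_univ μ)]

omit [∀ μ, NeZero (N μ)] in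
/-- the block sum of the squared second-order parts: `Σ_j |err₂(y,j,μ)|² ≤ L^{d−1}·(d/4)·Σ_ν |(D⁺_μD⁺_νλ)(y)|²`. [folklore] -/
theorem sum_norm_err2_sq_le (y : Tor N) (μ : Fin d) :
    ∑ j : Fin d → Fin L, ‖err2 L N Rc lam y j μ‖ ^ 2
      ≤ (L : ℝ) ^ (d - 1) * ((d : ℝ) / 4 * ∑ ν, ‖cD N Rc (fun z => cD N Rc lam z ν) y μ‖ ^ 2) := by
  set b : Fin d → ℝ := fun ν => ‖cD N Rc (fun z => cD N Rc lam z ν) y μ‖ with hb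
  have hcs : (∑ ν, b ν) ^ 2 ≤ d * ∑ ν, b ν ^ 2 := by
    have h := sq_sum_le_card_mul (Finset.univ : Finset (Fin d)) b
    rwa [Finset.card_univ, Fintype.card_fin] at h
  have hB : 0 ≤ (d : ℝ) / 4 * ∑ ν, b ν ^ 2 := by positivity
  have hpt : ∀ j : Fin d → Fin L, ‖err2 L N Rc lam y j μ‖ ^ 2
      ≤ (if (j μ : ℕ) + 1 = L then (1 : ℝ) else 0) * ((d : ℝ) / 4 * ∑ ν, b ν ^ 2) := by
    intro j
    have h := norm_err2_le L N Rc lam y j μ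
    split_ifs at h ⊢ with hj
    · rw [one_mul] at h ⊢
      have h2 := pow_le_pow_left₀ (norm_nonneg _) h 2
      refine h2.trans ?_
      rw [mul_pow]
      nlinarith [hcs]
    · rw [zero_mul] at h ⊢
      have : ‖err2 L N Rc lam y j μ‖ = 0 := le_antisymm h (norm_nonneg _)
      rw [this]; norm_num
  calc ∑ j : Fin d → Fin L, ‖err2 L N Rc lam y j μ‖ ^ 2
      ≤ ∑ j : Fin d → Fin L, (if (j μ : ℕ) + 1 = L then (1 : ℝ) else 0) * ((d : ℝ) / 4 * ∑ ν, b ν ^ 2) :=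
        Finset.sum_le_sum fun j _ => hpt j
    _ = (L : ℝ) ^ (d - 1) * ((d : ℝ) / 4 * ∑ ν, b ν ^ 2) := by rw [← Finset.sum_mul, sum_ind_last L μ]

omit [NeZero L] [∀ μ, NeZero (N μ)] in
/-- `L^{d−1} = L^d/L` and `L^{d−1} ≤ L^d` when a direction `μ : Fin d` exists (`d ≥ 1`, `L ≥ 1`). [folklore] -/
theorem pow_pred_eq (μ : Fin d) (hL : 1 ≤ L) : (L : ℝ) ^ (d - 1) = (L : ℝ) ^ d / L ∧ (L : ℝ) ^ (d - 1) ≤ (L : ℝ) ^ d := by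
  have hd : d - 1 + 1 = d := Nat.sub_add_cancel (Nat.succ_le_of_lt (Fin.pos μ))
  have hL' : (1 : ℝ) ≤ L := by exact_mod_cast hL
  have hL0 : (L : ℝ) ≠ 0 := by positivity
  have e : (L : ℝ) ^ d = (L : ℝ) ^ (d - 1) * L := by
    conv_lhs => rw [← hd]
    rw [pow_succ]
  refine ⟨by rw [e, mul_div_cancel_right₀ _ hL0], ?_⟩
  rw [e]
  exact le_mul_of_one_le_right (by positivity) hL'

/-- **THE GEOMETRIC PART, SUMMED** (unit coarse phases in direction `μ`): with `G = D⁺_μλ`,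
`Σ_y Σ_j |(1/L)G(y) + err₂(y,j,μ)|² ≤ L^d/L²·Σ_y|G(y)|² + (d/4 + 1/2)·L^d/L·Σ_ν Σ_y |(D⁺_μD⁺_νλ)(y)|²`.
The expansion is EXACT: main `L^d/L²·X_μ` (constant 1), cross `= +L^{d−2}(L−1)/(2L)·Σ_y|(D⁺_μD⁺_μλ)(y)|²` (`sum_err2` + `re_sum_conj_mul_cD`),
error by `sum_norm_err2_sq_le`. [folklore] -/
theorem sum_geo_sq_le (μ : Fin d) (hRc1 : ∀ y, ‖Rc y μ‖ = 1) :
    ∑ y : Tor N, ∑ j : Fin d → Fin L, ‖((L : ℂ))⁻¹ * cD N Rc lam y μ + err2 L N Rc lam y j μ‖ ^ 2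
      ≤ (L : ℝ) ^ d / (L : ℝ) ^ 2 * dirU N Rc lam μ
        + ((d : ℝ) / 4 + 1 / 2) * ((L : ℝ) ^ d / L) * ∑ ν, dirU N Rc (fun z => cD N Rc lam z ν) μ := by
  classical
  have hL1 : 1 ≤ L := Nat.one_le_iff_ne_zero.mpr (NeZero.ne L)
  have hL : (0 : ℝ) < L := by exact_mod_cast hL1
  obtain ⟨hpow, hpowle⟩ := pow_pred_eq L μ hL1
  obtain ⟨hw0, hw1⟩ := neg_wt_zero_mem L
  have hcard : ((Finset.univ : Finset (Fin d → Fin L)).card : ℝ) = (L : ℝ) ^ d := by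
    rw [Finset.card_univ, Fintype.card_fun, Fintype.card_fin, Fintype.card_fin]; push_cast; ring
  -- names
  set G : Tor N → ℂ := fun z => cD N Rc lam z μ with hG
  set DD : Fin d → Tor N → ℂ := fun ν y => cD N Rc (fun z => cD N Rc lam z ν) y μ with hDD
  set c : ℝ := (L : ℝ) ^ (d - 1) * wt L 0 with hc
  have hDDμ : ∀ y, DD μ y = cD N Rc G y μ := fun y => rfl
  -- two complex-number facts: `|a + e|² = |a|² + |e|² + 2·Re(a·conj e)` and `Re(z·conj w) = Re(conj z·w)`
  have norm_sq_add : ∀ a e : ℂ, ‖a + e‖ ^ 2 = ‖a‖ ^ 2 + ‖e‖ ^ 2 + 2 * (a * conj e).re := fun a e => by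
    rw [Complex.sq_norm, Complex.sq_norm, Complex.sq_norm, Complex.normSq_add]
  have re_mul_conj : ∀ z w : ℂ, (z * conj w).re = (conj z * w).re := fun z w => by
    rw [← Complex.conj_re (z * conj w), map_mul, Complex.conj_conj]
  -- per block: exact expansion
  have hblock : ∀ y : Tor N, ∑ j : Fin d → Fin L, ‖((L : ℂ))⁻¹ * cD N Rc lam y μ + err2 L N Rc lam y j μ‖ ^ 2
      = (L : ℝ) ^ d * (((L : ℝ))⁻¹ ^ 2 * ‖G y‖ ^ 2) + ∑ j : Fin d → Fin L, ‖err2 L N Rc lam y j μ‖ ^ 2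
        + 2 * (c * (((L : ℝ))⁻¹ * (conj (G y) * DD μ y).re)) := by
    intro y
    have ha : ‖((L : ℂ))⁻¹ * cD N Rc lam y μ‖ ^ 2 = ((L : ℝ))⁻¹ ^ 2 * ‖G y‖ ^ 2 := by
      rw [norm_mul, norm_inv, Complex.norm_natCast, mul_pow]
    have hmain : ∑ _j : Fin d → Fin L, ‖((L : ℂ))⁻¹ * cD N Rc lam y μ‖ ^ 2 = (L : ℝ) ^ d * (((L : ℝ))⁻¹ ^ 2 * ‖G y‖ ^ 2) := by
      rw [Finset.sum_const, nsmul_eq_mul, hcard, ha]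
    have hconj : conj (∑ j : Fin d → Fin L, err2 L N Rc lam y j μ) = ((c : ℝ) : ℂ) * conj (DD μ y) := by
      rw [sum_err2 L N Rc lam y μ, map_mul, Complex.conj_ofReal]
    have hcr : ∑ j : Fin d → Fin L, 2 * (((L : ℂ))⁻¹ * cD N Rc lam y μ * conj (err2 L N Rc lam y j μ)).re
        = 2 * (c * (((L : ℝ))⁻¹ * (conj (G y) * DD μ y).re)) := by
      rw [← Finset.mul_sum, ← Complex.re_sum, ← Finset.mul_sum, ← map_sum, hconj]
      congr 1
      have e : ((L : ℂ))⁻¹ * cD N Rc lam y μ * (((c : ℝ) : ℂ) * conj (DD μ y))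
          = ((c : ℝ) : ℂ) * ((((L : ℝ)⁻¹ : ℝ) : ℂ) * (G y * conj (DD μ y))) := by
        push_cast; simp only [hG]; ring
      rw [e, Complex.re_ofReal_mul, Complex.re_ofReal_mul, re_mul_conj]
    simp_rw [norm_sq_add]
    rw [Finset.sum_add_distrib, Finset.sum_add_distrib, hmain, hcr]
  -- sum over blocks
  rw [Finset.sum_congr rfl fun y _ => hblock y, Finset.sum_add_distrib, Finset.sum_add_distrib, ← Finset.mul_sum, ← Finset.mul_sum,
    ← Finset.mul_sum, ← Finset.mul_sum, ← Finset.mul_sum, ← Complex.re_sum]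
  -- the cross term, exactly
  have hcross : (∑ y : Tor N, conj (G y) * DD μ y).re = -(1 / 2) * ∑ y, ‖DD μ y‖ ^ 2 := by
    simp only [hDDμ]
    exact re_sum_conj_mul_cD N μ hRc1 G
  rw [hcross]
  -- the pieces as the named sums
  have hX : ∑ y : Tor N, ‖G y‖ ^ 2 = dirU N Rc lam μ := rfl
  have hH : ∀ ν, ∑ y : Tor N, ‖DD ν y‖ ^ 2 = dirU N Rc (fun z => cD N Rc lam z ν) μ := fun ν => rfl
  have hE : ∑ y : Tor N, ∑ j : Fin d → Fin L, ‖err2 L N Rc lam y j μ‖ ^ 2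
      ≤ (L : ℝ) ^ (d - 1) * ((d : ℝ) / 4 * ∑ ν, dirU N Rc (fun z => cD N Rc lam z ν) μ) := by
    calc ∑ y : Tor N, ∑ j : Fin d → Fin L, ‖err2 L N Rc lam y j μ‖ ^ 2
        ≤ ∑ y : Tor N, (L : ℝ) ^ (d - 1) * ((d : ℝ) / 4 * ∑ ν, ‖DD ν y‖ ^ 2) :=
          Finset.sum_le_sum fun y _ => sum_norm_err2_sq_le L N Rc lam y μ
      _ = (L : ℝ) ^ (d - 1) * ((d : ℝ) / 4 * ∑ ν, dirU N Rc (fun z => cD N Rc lam z ν) μ) := by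
          rw [← Finset.mul_sum, ← Finset.mul_sum, Finset.sum_comm]
          simp only [hH]
  have hHμ : dirU N Rc (fun z => cD N Rc lam z μ) μ ≤ ∑ ν, dirU N Rc (fun z => cD N Rc lam z ν) μ :=
    Finset.single_le_sum (f := fun ν => dirU N Rc (fun z => cD N Rc lam z ν) μ) (fun ν _ => dirU_nonneg _ _ _ _) (Finset.mem_univ μ)
  have hH0 : 0 ≤ dirU N Rc (fun z => cD N Rc lam z μ) μ := dirU_nonneg _ _ _ _
  have hS0 : 0 ≤ ∑ ν, dirU N Rc (fun z => cD N Rc lam z ν) μ := Finset.sum_nonneg fun ν _ => dirU_nonneg _ _ _ _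
  rw [hX, hH μ]
  -- cross coefficient: `2·c·L⁻¹·(−½)·H = (−w_L(0))·L^{d−1}·L⁻¹·H ≤ ½·L^{d−1}·H ≤ ½·(L^d/L)·H`
  have hcrossle : 2 * (c * (((L : ℝ))⁻¹ * (-(1 / 2) * dirU N Rc (fun z => cD N Rc lam z μ) μ)))
      ≤ 1 / 2 * ((L : ℝ) ^ d / L) * ∑ ν, dirU N Rc (fun z => cD N Rc lam z ν) μ := by
    have e : 2 * (c * (((L : ℝ))⁻¹ * (-(1 / 2) * dirU N Rc (fun z => cD N Rc lam z μ) μ)))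
        = (-wt L 0) * (((L : ℝ) ^ (d - 1) * ((L : ℝ))⁻¹) * dirU N Rc (fun z => cD N Rc lam z μ) μ) := by
      simp only [hc]; ring
    rw [e]
    have hLinv : ((L : ℝ))⁻¹ ≤ 1 := inv_le_one_of_one_le₀ (by exact_mod_cast hL1)
    have h1 : (L : ℝ) ^ (d - 1) * ((L : ℝ))⁻¹ ≤ (L : ℝ) ^ d / L := by
      rw [hpow]
      exact mul_le_of_le_one_right (by positivity) hLinv
    calc (-wt L 0) * (((L : ℝ) ^ (d - 1) * ((L : ℝ))⁻¹) * dirU N Rc (fun z => cD N Rc lam z μ) μ)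
        ≤ 1 / 2 * (((L : ℝ) ^ d / L) * ∑ ν, dirU N Rc (fun z => cD N Rc lam z ν) μ) :=
          mul_le_mul hw1 (mul_le_mul h1 hHμ hH0 (by positivity)) (by positivity) (by norm_num)
      _ = _ := by ring
  have hmain : (L : ℝ) ^ d * (((L : ℝ))⁻¹ ^ 2 * dirU N Rc lam μ) = (L : ℝ) ^ d / (L : ℝ) ^ 2 * dirU N Rc lam μ := by
    rw [inv_pow]; ring
  rw [hpow] at hE
  calc _ ≤ (L : ℝ) ^ d / (L : ℝ) ^ 2 * dirU N Rc lam μ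
        + (L : ℝ) ^ d / L * ((d : ℝ) / 4 * ∑ ν, dirU N Rc (fun z => cD N Rc lam z ν) μ)
        + 1 / 2 * ((L : ℝ) ^ d / L) * ∑ ν, dirU N Rc (fun z => cD N Rc lam z ν) μ :=
        add_le_add (add_le_add hmain.le hE) hcrossle
    _ = _ := by ring

variable {Rc lam}

/-- **LEAF ONE⁺, per direction (lattice units)**: for unit transports and the two one-step defects `≤ m`,
`dirU (fine L N) R′ Λ′ μ ≤ ( √(L^d/L²·X_μ + (d/4 + 1/2)·L^d/L·HESS_μ) + m·√(2(1+d²)·L^d·Σ|λ|²) )²`,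
`X_μ = Σ_y|(D⁺_μλ)(y)|²`, `HESS_μ = Σ_ν Σ_y|(D⁺_μD⁺_νλ)(y)|²`. [folklore] -/
theorem dirU_interp_le {T' : Tor (fine L N) → ℂ} (hT1 : ∀ x, ‖T' x‖ = 1) (hRc1 : ∀ y μ, ‖Rc y μ‖ = 1)
    {R' : Tor (fine L N) → Fin d → ℂ} {m : ℝ} (hm : 0 ≤ m)
    (hin : ∀ (y : Tor N) (j : Fin d → Fin L) (μ : Fin d), (j μ : ℕ) + 1 < L →
      ‖R' (bpt L N y j) μ * conj (T' (bpt L N y j + unitVec (fine L N) μ)) * T' (bpt L N y j) - 1‖ ≤ m)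
    (hcross : ∀ (y : Tor N) (j : Fin d → Fin L) (μ : Fin d), (j μ : ℕ) + 1 = L →
      ‖R' (bpt L N y j) μ * conj (T' (bpt L N y j + unitVec (fine L N) μ)) * T' (bpt L N y j) - Rc y μ‖ ≤ m)
    (μ : Fin d) :
    dirU (fine L N) R' (interp L N T' Rc lam) μ
      ≤ (Real.sqrt ((L : ℝ) ^ d / (L : ℝ) ^ 2 * dirU N Rc lam μ
            + ((d : ℝ) / 4 + 1 / 2) * ((L : ℝ) ^ d / L) * ∑ ν, dirU N Rc (fun z => cD N Rc lam z ν) μ)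
          + m * Real.sqrt (2 * (1 + (d : ℝ) ^ 2) * ((L : ℝ) ^ d * nsq lam))) ^ 2 := by
  have hRc : ∀ y μ, ‖Rc y μ‖ ≤ 1 := fun y μ => (hRc1 y μ).le
  -- the two block functionals, as functions of the pair (y, j)
  set A : Tor N × (Fin d → Fin L) → ℝ := fun p => ‖((L : ℂ))⁻¹ * cD N Rc lam p.1 μ + err2 L N Rc lam p.1 p.2 μ‖ with hA
  set B : Tor N × (Fin d → Fin L) → ℝ := fun p => ‖PhiF L N Rc lam (bpt L N p.1 p.2 + unitVec (fine L N) μ)‖ with hB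
  -- pointwise and summed
  have hpt : ∀ p : Tor N × (Fin d → Fin L),
      ‖cD (fine L N) R' (interp L N T' Rc lam) (bpt L N p.1 p.2) μ‖ ^ 2 ≤ (A p + m * B p) ^ 2 := fun p =>
    pow_le_pow_left₀ (norm_nonneg _) (norm_cD_interp_le L N Rc lam hT1 hin hcross p.1 p.2 μ) 2
  have hsum : dirU (fine L N) R' (interp L N T' Rc lam) μ ≤ ∑ p : Tor N × (Fin d → Fin L), (A p + m * B p) ^ 2 := by
    unfold dirU
    rw [sum_blocks_real L N (fun x => ‖cD (fine L N) R' (interp L N T' Rc lam) x μ‖ ^ 2), ← Fintype.sum_prod_type']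
    exact Finset.sum_le_sum fun p _ => hpt p
  have hmink := sum_sq_add_le (Finset.univ : Finset (Tor N × (Fin d → Fin L))) A B hm
  -- the two sums of squares
  have hA2 : ∑ p : Tor N × (Fin d → Fin L), A p ^ 2
      ≤ (L : ℝ) ^ d / (L : ℝ) ^ 2 * dirU N Rc lam μ
        + ((d : ℝ) / 4 + 1 / 2) * ((L : ℝ) ^ d / L) * ∑ ν, dirU N Rc (fun z => cD N Rc lam z ν) μ := by
    rw [Fintype.sum_prod_type]
    exact sum_geo_sq_le L N Rc lam μ (fun y => hRc1 y μ)
  have hB2 : ∑ p : Tor N × (Fin d → Fin L), B p ^ 2 ≤ 2 * (1 + (d : ℝ) ^ 2) * ((L : ℝ) ^ d * nsq lam) := by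
    have e : ∑ p : Tor N × (Fin d → Fin L), B p ^ 2 = nsq (PhiF L N Rc lam) := by
      rw [Fintype.sum_prod_type]
      simp only [hB]
      rw [← sum_blocks_real L N (fun x => ‖PhiF L N Rc lam (x + unitVec (fine L N) μ)‖ ^ 2)]
      exact Fintype.sum_equiv (Equiv.addRight (unitVec (fine L N) μ)) _ _ fun x => rfl
    rw [e]
    exact nsq_PhiF_le L N Rc lam hRc
  have hsA : Real.sqrt (∑ p : Tor N × (Fin d → Fin L), A p ^ 2)
      ≤ Real.sqrt ((L : ℝ) ^ d / (L : ℝ) ^ 2 * dirU N Rc lam μ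
          + ((d : ℝ) / 4 + 1 / 2) * ((L : ℝ) ^ d / L) * ∑ ν, dirU N Rc (fun z => cD N Rc lam z ν) μ) := Real.sqrt_le_sqrt hA2
  have hsB : Real.sqrt (∑ p : Tor N × (Fin d → Fin L), B p ^ 2) ≤ Real.sqrt (2 * (1 + (d : ℝ) ^ 2) * ((L : ℝ) ^ d * nsq lam)) :=
    Real.sqrt_le_sqrt hB2
  have h0 : 0 ≤ Real.sqrt (∑ p : Tor N × (Fin d → Fin L), A p ^ 2) + m * Real.sqrt (∑ p : Tor N × (Fin d → Fin L), B p ^ 2) := by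
    positivity
  calc dirU (fine L N) R' (interp L N T' Rc lam) μ ≤ _ := hsum
    _ ≤ _ := hmink
    _ ≤ _ := pow_le_pow_left₀ h0 (add_le_add hsA (mul_le_mul_of_nonneg_left hsB hm)) 2

/-- **LEAF ONE⁺ (lattice units)**: the covariant Dirichlet sum of the competitor `Λ′` over the fine torus,
`Σ_μ dirU (fine L N) R′ Λ′ μ ≤ ( √(L^d/L²·X + (d/4 + 1/2)·L^d/L·HESS) + √d·m·√(2(1+d²)·L^d·Σ|λ|²) )²`
with `X = Σ_μ dirU N Rc λ μ` (MAIN TERM, constant EXACTLY 1 after the physical prefactors) and `HESS = hess N Rc λ`. [folklore] -/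
theorem sum_dirU_interp_le {T' : Tor (fine L N) → ℂ} (hT1 : ∀ x, ‖T' x‖ = 1) (hRc1 : ∀ y μ, ‖Rc y μ‖ = 1)
    {R' : Tor (fine L N) → Fin d → ℂ} {m : ℝ} (hm : 0 ≤ m)
    (hin : ∀ (y : Tor N) (j : Fin d → Fin L) (μ : Fin d), (j μ : ℕ) + 1 < L →
      ‖R' (bpt L N y j) μ * conj (T' (bpt L N y j + unitVec (fine L N) μ)) * T' (bpt L N y j) - 1‖ ≤ m)
    (hcross : ∀ (y : Tor N) (j : Fin d → Fin L) (μ : Fin d), (j μ : ℕ) + 1 = L →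
      ‖R' (bpt L N y j) μ * conj (T' (bpt L N y j + unitVec (fine L N) μ)) * T' (bpt L N y j) - Rc y μ‖ ≤ m) :
    ∑ μ, dirU (fine L N) R' (interp L N T' Rc lam) μ
      ≤ (Real.sqrt ((L : ℝ) ^ d / (L : ℝ) ^ 2 * (∑ μ, dirU N Rc lam μ) + ((d : ℝ) / 4 + 1 / 2) * ((L : ℝ) ^ d / L) * hess N Rc lam)
          + Real.sqrt d * (m * Real.sqrt (2 * (1 + (d : ℝ) ^ 2) * ((L : ℝ) ^ d * nsq lam)))) ^ 2 := by
  have hb0 : 0 ≤ m * Real.sqrt (2 * (1 + (d : ℝ) ^ 2) * ((L : ℝ) ^ d * nsq lam)) := mul_nonneg hm (Real.sqrt_nonneg _)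
  have hA0 : ∀ μ : Fin d, 0 ≤ (L : ℝ) ^ d / (L : ℝ) ^ 2 * dirU N Rc lam μ
      + ((d : ℝ) / 4 + 1 / 2) * ((L : ℝ) ^ d / L) * ∑ ν, dirU N Rc (fun z => cD N Rc lam z ν) μ := fun μ =>
    add_nonneg (mul_nonneg (by positivity) (dirU_nonneg _ _ _ _))
      (mul_nonneg (by positivity) (Finset.sum_nonneg fun ν _ => dirU_nonneg _ _ _ _))
  have hsumA : ∑ μ : Fin d, Real.sqrt ((L : ℝ) ^ d / (L : ℝ) ^ 2 * dirU N Rc lam μ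
        + ((d : ℝ) / 4 + 1 / 2) * ((L : ℝ) ^ d / L) * ∑ ν, dirU N Rc (fun z => cD N Rc lam z ν) μ) ^ 2
      = (L : ℝ) ^ d / (L : ℝ) ^ 2 * (∑ μ, dirU N Rc lam μ) + ((d : ℝ) / 4 + 1 / 2) * ((L : ℝ) ^ d / L) * hess N Rc lam := by
    rw [Finset.sum_congr rfl fun μ _ => Real.sq_sqrt (hA0 μ), Finset.sum_add_distrib, ← Finset.mul_sum, ← Finset.mul_sum]
    rfl
  calc ∑ μ, dirU (fine L N) R' (interp L N T' Rc lam) μ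
      ≤ ∑ μ : Fin d, (Real.sqrt ((L : ℝ) ^ d / (L : ℝ) ^ 2 * dirU N Rc lam μ
            + ((d : ℝ) / 4 + 1 / 2) * ((L : ℝ) ^ d / L) * ∑ ν, dirU N Rc (fun z => cD N Rc lam z ν) μ)
          + m * Real.sqrt (2 * (1 + (d : ℝ) ^ 2) * ((L : ℝ) ^ d * nsq lam))) ^ 2 :=
        Finset.sum_le_sum fun μ _ => dirU_interp_le L N hT1 hRc1 hm hin hcross μ
    _ ≤ _ := sum_fin_sq_add_le _ hb0
    _ = _ := by rw [hsumA]

/-- **LEAF ONE⁺, `∃`-form (lattice units)**: a fine field meeting the transported constraint EXACTLY with the bound above. [folklore] -/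
theorem exists_oneStep_lattice {T' : Tor (fine L N) → ℂ} (hT1 : ∀ x, ‖T' x‖ = 1) (hRc1 : ∀ y μ, ‖Rc y μ‖ = 1)
    {R' : Tor (fine L N) → Fin d → ℂ} {m : ℝ} (hm : 0 ≤ m)
    (hin : ∀ (y : Tor N) (j : Fin d → Fin L) (μ : Fin d), (j μ : ℕ) + 1 < L →
      ‖R' (bpt L N y j) μ * conj (T' (bpt L N y j + unitVec (fine L N) μ)) * T' (bpt L N y j) - 1‖ ≤ m)
    (hcross : ∀ (y : Tor N) (j : Fin d → Fin L) (μ : Fin d), (j μ : ℕ) + 1 = L →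
      ‖R' (bpt L N y j) μ * conj (T' (bpt L N y j + unitVec (fine L N) μ)) * T' (bpt L N y j) - Rc y μ‖ ≤ m) :
    ∃ f' : Tor (fine L N) → ℂ, (fun y => Qc L N T' f' y) = lam ∧
      ∑ μ, dirU (fine L N) R' f' μ
        ≤ (Real.sqrt ((L : ℝ) ^ d / (L : ℝ) ^ 2 * (∑ μ, dirU N Rc lam μ) + ((d : ℝ) / 4 + 1 / 2) * ((L : ℝ) ^ d / L) * hess N Rc lam)
            + Real.sqrt d * (m * Real.sqrt (2 * (1 + (d : ℝ) ^ 2) * ((L : ℝ) ^ d * nsq lam)))) ^ 2 :=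
  ⟨interp L N T' Rc lam, Qc_interp L N Rc lam hT1, sum_dirU_interp_le L N hT1 hRc1 hm hin hcross⟩

end Lattice

end Summit.QuantumFields.BalabanUV.T4Continuum.VariationalCovariantOneStep

end
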